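import Summits.KontsevichZagierPeriods.KontsevichZagierPeriods.Theorems.HurwitzMicroSectorsNormalFormPrincipleL2W3PrismShuffle
import Summits.KontsevichZagierPeriods.KontsevichZagierPeriods.Theorems.HurwitzMicroSectorsNormalFormPrincipleL2W3PrismDilationMove
import Summits.KontsevichZagierPeriods.KontsevichZagierPeriods.Theorems.HurwitzMicroSectorsNormalFormPrincipleL2W3RelationsDilation
import Summits.KontsevichZagierPeriods.KontsevichZagierPeriods.Theorems.HyperbolicBlochOffTetraSectorKernelStubAffineOrbit

/-!
# `NormalFormPrinciple` (stmt-KontsevichZagierPeriods-3869), line `SketchIdeator1` —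
# leaf `stub_boxRigidity`, layer `L2W3` (level-2 weight-3 descent): the shuffle relation

Pure proof file (registered sub-goal `l2w3_relation_shuffle`, lead seat c9; `--supports` the
crux). Letters `a(u) = 1/u`, `b(u) = 1/(1−u)`, `c(u) = 1/(1+u)`; word representations
`[x y z] = [Δ, x(t₀)y(t₁)z(t₂)]` on the decreasing open simplex `Δ`, and PRODUCT representations
`[P, x(t₀)y(t₁)·z(t₂)]` on the prism `P = {1 > t₀ > t₁ > 0} × {0 < t₂ < 1}` (value
`(∫ x y)·(∫ z)`). Two mechanisms of the calculus meet here: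

* the SHUFFLE PRODUCT as a dissection (rule (1a) + coordinate permutations, the landed move
  `l2w3_prism_shuffle`): `[P, ab ⊗ c] = [abc] + [acb] + [cab]` and `[P, ac ⊗ c] = 2[acc] + [cac]`;
* the weight-two DISTRIBUTION relation `∫ab = 2∫ab − 2∫ac` (i.e. `Li₂(1) = 2(Li₂(1) + Li₂(−1))`)
  multiplied by `∫c = log 2`, as ONE change of variables on `P` — the partial dilation
  `(t₀,t₁,t₂) ↦ (t₀²,t₁²,t₂)` (rule (2), the landed move `l2w3_prism_dilation_move`):
  `[P, ab ⊗ c] = 2[P, ab ⊗ c] − 2[P, ac ⊗ c]`.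

Together (part (2) of the registered statement): `4[acc] + 2[cac] − [abc] − [acb] − [cab] ∈
KZ.relations` — the shuffle relation `(log 2)·(∫ac) = (log 2)·½ζ(2)` read among weight-3 words, the
only place where the evaluation `ζ(2)·log 2` enters the half-point identity
`4∫dV/((2−x)(1−xyz)) = 3ζ(2)log 2`. Part (1) is the plain shuffle `[P, ab ⊗ c] = [abc]+[acb]+[cab]`.
References: M. Kontsevich, D. Zagier, *Periods* (2001), §1.2; K. Ihara, M. Kaneko, D. Zagier,
*Derivation and double shuffle relations for multiple zeta values*, Compos. Math. 142 (2006), §1.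
No definitions are introduced.
-/

noncomputable section

open MeasureTheory Set
open Literature.NumberTheory.Transcendental Literature.NumberTheory.Transcendental.KZ
open Literature.ModelTheory.ExponentialFields (IsSemialgebraic)
open Summit.KontsevichZagierPeriods.HyperbolicBloch.OffTetraSectorKernel
  (aff_orbit_of_sub_sum_zsmul_mem_relations)

namespace Summit.KontsevichZagierPeriods.HurwitzMicroSectors.NormalFormPrinciple.PiBox.M3

/-- Coordinate facts on the prism `P`. [folklore] -/
theorem l2x_prism_facts {s : Fin 3 → ℝ}
    (hs : s ∈ {t : Fin 3 → ℝ | 0 < t 1 ∧ t 1 < t 0 ∧ t 0 < 1 ∧ 0 < t 2 ∧ t 2 < 1}) :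
    0 < s 0 ∧ s 0 < 1 ∧ 0 < s 1 ∧ s 1 < 1 ∧ 0 < s 2 ∧ s 2 < 1 := by
  obtain ⟨h1, h10, h0, h2, h21⟩ := hs
  exact ⟨by linarith, h0, h1, by linarith, h2, h21⟩

/-- **Stub (`l2w3_relation_shuffle`; registered sub-goal of stmt-KontsevichZagierPeriods-3869,
line `SketchIdeator1`, layer `L2W3`).** For arbitrary carriers with the displayed integrands —
the product representations `[P, ab ⊗ c]`, `[P, ac ⊗ c]` on the prism and the words `abc`, `acb`,
`cab`, `acc`, `cac` on the simplex: (1) the shuffle `[P, ab ⊗ c] − [abc] − [acb] − [cab] ∈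
KZ.relations`; (2) `4[acc] + 2[cac] − [abc] − [acb] − [cab] ∈ KZ.relations` (shuffles of both
products and ONE partial dilation move on the prism). [cite: KontsevichZagier2001, §1.2 rules (1), (2)] -/
theorem l2w3_relation_shuffle :
    ∀ (PABC PACC ABC ACB CAB ACC CAC : IntegralRep 3),
      PABC.domain = {t | 0 < t 1 ∧ t 1 < t 0 ∧ t 0 < 1 ∧ 0 < t 2 ∧ t 2 < 1} →
      (PABC.integrand = fun t => 1 / t 0 * (1 / (1 - t 1)) * (1 / (1 + t 2))) →
      PACC.domain = {t | 0 < t 1 ∧ t 1 < t 0 ∧ t 0 < 1 ∧ 0 < t 2 ∧ t 2 < 1} →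
      (PACC.integrand = fun t => 1 / t 0 * (1 / (1 + t 1)) * (1 / (1 + t 2))) →
      ABC.domain = {t | 0 < t 2 ∧ t 2 < t 1 ∧ t 1 < t 0 ∧ t 0 < 1} → (ABC.integrand = fun t => 1 / t 0 * (1 / (1 - t 1)) * (1 / (1 + t 2))) →
      ACB.domain = {t | 0 < t 2 ∧ t 2 < t 1 ∧ t 1 < t 0 ∧ t 0 < 1} → (ACB.integrand = fun t => 1 / t 0 * (1 / (1 + t 1)) * (1 / (1 - t 2))) →
      CAB.domain = {t | 0 < t 2 ∧ t 2 < t 1 ∧ t 1 < t 0 ∧ t 0 < 1} → (CAB.integrand = fun t => 1 / (1 + t 0) * 1 / t 1 * (1 / (1 - t 2))) →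
      ACC.domain = {t | 0 < t 2 ∧ t 2 < t 1 ∧ t 1 < t 0 ∧ t 0 < 1} → (ACC.integrand = fun t => 1 / t 0 * (1 / (1 + t 1)) * (1 / (1 + t 2))) →
      CAC.domain = {t | 0 < t 2 ∧ t 2 < t 1 ∧ t 1 < t 0 ∧ t 0 < 1} → (CAC.integrand = fun t => 1 / (1 + t 0) * 1 / t 1 * (1 / (1 + t 2))) →
      (of PABC - of ABC - of ACB - of CAB ∈ relations) ∧
      ((4:ℤ) • of ACC + (2:ℤ) • of CAC - of ABC - of ACB - of CAB ∈ relations) := by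
  intro PABC PACC ABC ACB CAB ACC CAC hPABCd hPABCi hPACCd hPACCi hABCd hABCi hACBd hACBi hCABd hCABi
    hACCd hACCi hCACd hCACi
  -- (S1) the shuffle `[P, ab ⊗ c] = [abc] + [acb] + [cab]`
  have s1 : of PABC - of ABC - of ACB - of CAB ∈ relations :=
    l2w3_prism_shuffle (fun u => 1 / u) (fun u => 1 / (1 - u)) (fun u => 1 / (1 + u)) PABC ABC ACB CAB
      hPABCd (hPABCi ▸ fun _ _ => rfl) hABCd (hABCi ▸ fun _ _ => rfl) hACBd (hACBi ▸ fun _ _ => rfl)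
      hCABd (fun t _ => by simp only [hCABi]; ring)
  refine ⟨s1, ?_⟩
  -- (S2) the shuffle `[P, ac ⊗ c] = [acc] + [acc] + [cac]`
  have s2 : of PACC - of ACC - of ACC - of CAC ∈ relations :=
    l2w3_prism_shuffle (fun u => 1 / u) (fun u => 1 / (1 + u)) (fun u => 1 / (1 + u)) PACC ACC ACC CAC
      hPACCd (hPACCi ▸ fun _ _ => rfl) hACCd (hACCi ▸ fun _ _ => rfl) hACCd (hACCi ▸ fun _ _ => rfl)
      hCACd (fun t _ => by simp only [hCACi]; ring)
  -- (Dπ) ONE partial dilation on the prism: `[P, ab ⊗ c] = 2[P, ab ⊗ c] − 2[P, ac ⊗ c]`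
  have d0 : of PABC - (2:ℤ) • of PACC ∈ relations := by
    obtain ⟨hmove, N, hNd, hNi⟩ := l2w3_prism_dilation_move (fun u => 1 / u) (fun u => 1 / (1 - u))
      (fun u => 1 / (1 + u)) PABC hPABCd (hPABCi ▸ fun _ _ => rfl)
    have m1 : of N - of PABC ∈ relations := hmove N hNd (hNi ▸ fun _ _ => rfl)
    have m2 : of N - ((2:ℤ) • of PABC + (-2:ℤ) • of PACC) ∈ relations := by
      have h := aff_orbit_of_sub_sum_zsmul_mem_relations (Finset.univ : Finset (Fin 2))
        ![PABC, PACC] ![2, -2] N (fun i _ => by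
          fin_cases i
          · exact hPABCd.trans hNd.symm
          · exact hPACCd.trans hNd.symm) fun s hs => ?_
      · simpa [Fin.sum_univ_two] using h
      have hf := l2x_prism_facts (hNd ▸ hs)
      rw [hNi]
      simp only [Fin.sum_univ_two, Matrix.cons_val_zero, Matrix.cons_val_one, hPABCi, hPACCi]
      rw [(l2v_dilation_letter_pulls hf.1 hf.2.1).1, (l2v_dilation_letter_pulls hf.2.2.1 hf.2.2.2.1).2]
      push_cast
      ring
    have e : of PABC - (2:ℤ) • of PACC =
        (of N - of PABC) - (of N - ((2:ℤ) • of PABC + (-2:ℤ) • of PACC)) := by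
      simp only [neg_smul]; abel
    rw [e]
    exact relations.sub_mem m1 m2
  -- bookkeeping: `4[acc] + 2[cac] − [abc] − [acb] − [cab] = −2·s2 − d0 + s1`
  have e : (4:ℤ) • of ACC + (2:ℤ) • of CAC - of ABC - of ACB - of CAB =
      -((2:ℤ) • (of PACC - of ACC - of ACC - of CAC)) - (of PABC - (2:ℤ) • of PACC)
        + (of PABC - of ABC - of ACB - of CAB) := by
    simp only [smul_sub]
    abel
  rw [e]
  exact relations.add_mem (relations.sub_mem (relations.neg_mem (relations.zsmul_mem s2 2)) d0) s1

end Summit.KontsevichZagierPeriods.HurwitzMicroSectors.NormalFormPrinciple.PiBox.M3
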